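import Summits.QuantumFields.BalabanUV.Beta.EriceFlowEnclosureBareCouplingSums
import Literature.MathematicalPhysics.QuantumFieldTheory.BalabanJaffe1986.BJ86CouplingRenormalization

/-!
# Beta / EriceFlowEnclosureBareCouplingRun — ONE RUN of Erice (3.62) read from the unit-lattice end: the two-loop
# bookkeeping of (3.73)–(3.76) with explicit constants (β-flow team, prover 1, unit `b2b-balaban-beta-bflow-p1`, gen 4)

HONEST FRAMING (page 1 of everything the β sub-cell writes): discharging `BetaPertH` makes Bałaban's UV stability
UNCONDITIONAL — a real constructive-QFT result; it is NOT the continuum limit and NOT the Clay problem.  HONEST DEPENDENCY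
(cell reorg 2026-08-19, verbatim): «continuum YM on T⁴ ⇐ BetaPertH ∧ nine spine estimates (0/9 proved); BetaPertH ⇐ (D1) ∧
(D4) ∧ CAP+tail; G-an2-4 gates asym, D1 and NE2/3/4.»  THIS MODULE DISCHARGES NOTHING OF BAŁABAN'S: every Erice sentence enters as a
HYPOTHESIS by its typed name in the records `BalabanJaffe1986.BJ86CouplingRenormalization` (typers beta-erice-lit1∕2) —
(3.62) `Recursion362 βE gsq K`, (3.71) `gsq K = g²`, (3.69) along the run `AlongRun369 βE gsq β″ β′ 0 K` (from the BARE
end `n₀ = 0`, which is how (3.70) with `k = 0` and the sum `Σ_{n=0}^{K−1}` of (3.74) use it; the steps `n < n₀` are the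
small-n list, gap G-2 of the series), (3.73) `TaylorSplit373 βE β₀seq β₂seq C s₀` in its n-UNIFORM reading (fit-ref2
R2-F9 (b), R2-F15 (i)); positivity of the run and `g² ≤ s₀` keep it inside the Taylor range.  Nothing is asserted of
Bałaban's β-functions (1.22); the family `βE n` is Erice's Markov print (gap G4).

WHAT THIS FILE PROVES ([folklore] real analysis over those records; `x_n = 1/g_n²`, `m = K − n`,
`y_n = 1/g² + |β₀|m` the ONE-LOOP LINE, `P(k) = Σ_{j<k} β_{j,0} − β₀k` the DRIFT DEFECT — row D1's currency
`Beta.Drift.OneLoopDrift β₀ A β₀seq` reads `|P(k)| ≤ A`).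
§1 `inv_gsq_eq_sub_tail` ((3.70) from the unit end), `lower_running` (`1/g² + |β′|m ≤ x_n`, (3.72) left half),
   `gsq_le_of_run` (`g_n² ≤ 1/(|β′|m)`, `g_n² ≤ g²`), `taylorConst_nonneg`.
§2 `tail_split` ((3.74) between `n` and `K`: one-loop `β₀m` + `P(K) − P(n)` + two-loop sum + remainder sum),
   `abs_tail_twoLoop_le` (`≤ (2B₂/|β′|)√m`), `abs_tail_remainder_le` (`≤ 2C/β′²` — R2-F15 (i): needs the n-UNIFORM `C`),
   `abs_inv_gsq_sub_line_le` (`|x_n − y_n| ≤ D + (2B₂/|β′|)√m + 2C/β′²`, `D` a bound on the window defect `|P(K) − P(n)|`).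
§3 `abs_sum_gsq_sub_sum_invLine_le` — THE CORE COMPARISON `|Σ_{j<K} g_j² − Σ_{j<K} 1/y_j| ≤ 3·(D·g/(2√|β′||β₀|) +
   (2C/β′² + 2B₂/|β′|)/(|β′||β₀|))` (the `D`-part carries the factor `g`); `abs_twoLoop_sub_le_of_iii` (R2-F15 (iii) at
   `K = n+1` bounds `|β_{n,2} − β₂| ≤ E`); `run_assembly`: with `M_K = 1/g² − β₀K − (β₂/|β₀|)·log K`,
   `|1/g₀² − M_K + P(K)| ≤ 2C/β′² + E/|β′| + |β₂|·(3·coef(D) + 2g⁻²/β₀² + 1/|β₀|)` — the one inequality both directions of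
   `EriceFlowEnclosureBareCoupling` consume.
Imports the sibling `EriceFlowEnclosureBareCouplingSums` and the records; 0 `def`, 0 `sorry`.  NOT `BetaPertH`, NOT
continuum, NOT Clay.
-/

namespace Summit.QuantumFields.BalabanUV.Beta.EriceFlowEnclosureBareCouplingRun

open Finset Real
open Literature.MathematicalPhysics.QuantumFieldTheory.BalabanJaffe1986.BJ86CouplingRenormalization
open Literature.MathematicalPhysics.QuantumFieldTheory.Balaban1983to89.T4TwoLoopLaw
open Literature.MathematicalPhysics.QuantumLattice
open Summit.QuantumFields.BalabanUV.Beta.EriceFlowEnclosureBareCouplingSums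

noncomputable section

/-! ## §1 The run read from the unit-lattice end: (3.70), (3.72) left half, the Taylor range -/

/-- (3.70) read from the unit-lattice end (3.71): along a run, `1/g_n² = 1/g² − Σ_{n ≤ j < K} β_j(g_j²)`. -/
theorem inv_gsq_eq_sub_tail {βE : ℕ → ℝ → ℝ} {gsq : ℕ → ℝ} {K : ℕ} {g : ℝ}
    (h362 : Recursion362 βE gsq K) (h371 : gsq K = g ^ 2) {n : ℕ} (hn : n ≤ K) :
    1 / gsq n = 1 / g ^ 2 - ∑ j ∈ Ico n K, βE j (gsq j) := by
  have h := telescope370 h362 hn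
  rw [h371] at h
  linarith

/-- Lower running bound from (3.69)'s upper member along the run from the bare end (what (3.72)'s left half says, in
the form `1/g² + |β′|(K − n) ≤ 1/g_n²`). -/
theorem lower_running {βE : ℕ → ℝ → ℝ} {gsq : ℕ → ℝ} {K : ℕ} {g β'' β' : ℝ}
    (h362 : Recursion362 βE gsq K) (h371 : gsq K = g ^ 2) (h369 : AlongRun369 βE gsq β'' β' 0 K)
    {n : ℕ} (hn : n ≤ K) :
    1 / g ^ 2 + (-β') * ((K : ℝ) - n) ≤ 1 / gsq n := by
  rw [inv_gsq_eq_sub_tail h362 h371 hn]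
  have hcard : ((Ico n K).card : ℝ) = (K : ℝ) - n := by
    rw [Nat.card_Ico, Nat.cast_sub hn]
  have hup : ∑ j ∈ Ico n K, βE j (gsq j) ≤ ((K : ℝ) - n) * β' := by
    have h1 := Finset.sum_le_card_nsmul (Ico n K) (fun j => βE j (gsq j)) β'
      (fun j hj => (h369 j (Nat.zero_le _) (Finset.mem_Ico.mp hj).2).2)
    rw [nsmul_eq_mul, hcard] at h1
    exact h1
  linarith

/-- Along the run: `0 < |β′|(K − n) ≤ 1/g_n²`, so `g_n² ≤ 1/(|β′|(K − n))` for `n < K`, and `g_n² ≤ g²` for `n ≤ K`. -/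
theorem gsq_le_of_run {βE : ℕ → ℝ → ℝ} {gsq : ℕ → ℝ} {K : ℕ} {g β'' β' : ℝ}
    (h362 : Recursion362 βE gsq K) (h371 : gsq K = g ^ 2) (h369 : AlongRun369 βE gsq β'' β' 0 K)
    (hβ' : β' < 0) (hg : 0 < g) (hpos : ∀ n, n ≤ K → 0 < gsq n) {n : ℕ} (hn : n < K) :
    gsq n ≤ 1 / ((-β') * ((K : ℝ) - n)) ∧ gsq n ≤ g ^ 2 := by
  have hlow := lower_running h362 h371 h369 hn.le
  have hKn : (1 : ℝ) ≤ (K : ℝ) - n := by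
    have : (n : ℝ) + 1 ≤ K := by exact_mod_cast hn
    linarith
  have hg2 : 0 < 1 / g ^ 2 := by positivity
  have hb : 0 < (-β') * ((K : ℝ) - n) := mul_pos (by linarith) (by linarith)
  have hp := hpos n hn.le
  constructor
  · rw [le_one_div hp hb]
    calc (-β') * ((K : ℝ) - n) ≤ 1 / g ^ 2 + (-β') * ((K : ℝ) - n) := by linarith
      _ ≤ 1 / gsq n := hlow
  · have h1 : 1 / g ^ 2 ≤ 1 / gsq n := by linarith [hb.le]
    exact (one_div_le_one_div (by positivity) hp).mp h1

/-- The n-uniform remainder constant of (3.73) is nonnegative as soon as the Taylor range contains a positive point. -/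
theorem taylorConst_nonneg {βE : ℕ → ℝ → ℝ} {β₀seq β₂seq : ℕ → ℝ} {C s₀ g : ℝ}
    (h373 : TaylorSplit373 βE β₀seq β₂seq C s₀) (hg : 0 < g) (hgs₀ : g ^ 2 ≤ s₀) : 0 ≤ C := by
  have hT := h373 0 (g ^ 2) (by positivity) hgs₀
  by_contra hC
  push Not at hC
  have : C * (g ^ 2) ^ 2 < 0 := mul_neg_of_neg_of_pos hC (by positivity)
  linarith [abs_nonneg (βE 0 (g ^ 2) - (β₀seq 0 + β₂seq 0 * g ^ 2))]

/-! ## §2 (3.74) over a tail window and the deviation from the one-loop line -/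

/-- The Taylor split (3.73) summed over a tail window (the substitution (3.74) between steps `n` and `K`): one-loop
part `β₀(K − n)` + the DRIFT DEFECTS `P(K) − P(n)` (`P(k) = Σ_{j<k} β_{j,0} − β₀k`, row D1's currency) + the two-loop
sum + the remainder sum. -/
theorem tail_split {βE : ℕ → ℝ → ℝ} {gsq : ℕ → ℝ} (β₀seq β₂seq : ℕ → ℝ) (β₀ : ℝ) {n K : ℕ} (hn : n ≤ K) :
    ∑ j ∈ Ico n K, βE j (gsq j) =
      β₀ * ((K : ℝ) - n) +
        ((∑ j ∈ range K, β₀seq j - β₀ * K) - (∑ j ∈ range n, β₀seq j - β₀ * n)) +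
        ∑ j ∈ Ico n K, β₂seq j * gsq j +
        ∑ j ∈ Ico n K, (βE j (gsq j) - β₀seq j - β₂seq j * gsq j) := by
  have h1 : ∑ j ∈ Ico n K, βE j (gsq j) =
      ∑ j ∈ Ico n K, (β₀seq j + (β₂seq j * gsq j + (βE j (gsq j) - β₀seq j - β₂seq j * gsq j))) :=
    Finset.sum_congr rfl fun j _ => by ring
  rw [h1, Finset.sum_add_distrib, Finset.sum_add_distrib, Finset.sum_Ico_eq_sub _ hn]
  ring

/-- The two-loop sum over a tail window: `|Σ_{n≤j<K} β_{j,2} g_j²| ≤ (2B₂/|β′|)·√(K − n)`. -/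
theorem abs_tail_twoLoop_le {βE : ℕ → ℝ → ℝ} {gsq : ℕ → ℝ} {K : ℕ} {g β'' β' : ℝ}
    (h362 : Recursion362 βE gsq K) (h371 : gsq K = g ^ 2) (h369 : AlongRun369 βE gsq β'' β' 0 K)
    (hβ' : β' < 0) (hg : 0 < g) (hpos : ∀ n, n ≤ K → 0 < gsq n)
    {β₂seq : ℕ → ℝ} {B₂ : ℝ} (hB₂ : ∀ j, |β₂seq j| ≤ B₂) {n : ℕ} (hn : n ≤ K) :
    |∑ j ∈ Ico n K, β₂seq j * gsq j| ≤ 2 * B₂ / (-β') * Real.sqrt ((K : ℝ) - n) := by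
  have hB₂0 : 0 ≤ B₂ := le_trans (abs_nonneg _) (hB₂ 0)
  have hterm : ∀ j ∈ Ico n K, |β₂seq j * gsq j| ≤ B₂ / (-β') * (1 / ((K : ℝ) - j)) := by
    intro j hj
    have hjK := (Finset.mem_Ico.mp hj).2
    have hgs := (gsq_le_of_run h362 h371 h369 hβ' hg hpos hjK).1
    have hp := hpos j hjK.le
    rw [abs_mul, abs_of_pos hp]
    calc |β₂seq j| * gsq j ≤ B₂ * (1 / ((-β') * ((K : ℝ) - j))) :=
          mul_le_mul (hB₂ j) hgs hp.le hB₂0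
      _ = B₂ / (-β') * (1 / ((K : ℝ) - j)) := by
          field_simp
  calc |∑ j ∈ Ico n K, β₂seq j * gsq j| ≤ ∑ j ∈ Ico n K, |β₂seq j * gsq j| := Finset.abs_sum_le_sum_abs _ _
    _ ≤ ∑ j ∈ Ico n K, B₂ / (-β') * (1 / ((K : ℝ) - j)) := Finset.sum_le_sum hterm
    _ = B₂ / (-β') * ∑ i ∈ range (K - n), 1 / ((i : ℝ) + 1) := by
          rw [← Finset.mul_sum, sum_Ico_reflect_sub (fun x => 1 / x) hn]
    _ ≤ B₂ / (-β') * (2 * Real.sqrt ((K - n : ℕ) : ℝ)) :=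
          mul_le_mul_of_nonneg_left (sum_inv_le_two_sqrt (K - n)) (div_nonneg hB₂0 (by linarith))
    _ = 2 * B₂ / (-β') * Real.sqrt ((K : ℝ) - n) := by
          rw [Nat.cast_sub hn]
          ring

/-- The remainder sum over a tail window under the n-UNIFORM (3.73): `|Σ_{n≤j<K} r_j| ≤ 2C/β′²`. -/
theorem abs_tail_remainder_le {βE : ℕ → ℝ → ℝ} {gsq : ℕ → ℝ} {K : ℕ} {g β'' β' : ℝ}
    (h362 : Recursion362 βE gsq K) (h371 : gsq K = g ^ 2) (h369 : AlongRun369 βE gsq β'' β' 0 K)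
    (hβ' : β' < 0) (hg : 0 < g) (hpos : ∀ n, n ≤ K → 0 < gsq n)
    {β₀seq β₂seq : ℕ → ℝ} {C s₀ : ℝ} (h373 : TaylorSplit373 βE β₀seq β₂seq C s₀) (hgs₀ : g ^ 2 ≤ s₀)
    {n : ℕ} (hn : n ≤ K) :
    |∑ j ∈ Ico n K, (βE j (gsq j) - β₀seq j - β₂seq j * gsq j)| ≤ 2 * C / β' ^ 2 := by
  have hC : 0 ≤ C := taylorConst_nonneg h373 hg hgs₀
  have hterm : ∀ j ∈ Ico n K,
      |βE j (gsq j) - β₀seq j - β₂seq j * gsq j| ≤ C / β' ^ 2 * (1 / ((K : ℝ) - j) ^ 2) := by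
    intro j hj
    have hjK := (Finset.mem_Ico.mp hj).2
    have hgs := gsq_le_of_run h362 h371 h369 hβ' hg hpos hjK
    have hp := hpos j hjK.le
    have hT := h373 j (gsq j) hp.le (hgs.2.trans hgs₀)
    rw [sub_sub]
    calc |βE j (gsq j) - (β₀seq j + β₂seq j * gsq j)| ≤ C * gsq j ^ 2 := hT
      _ ≤ C * (1 / ((-β') * ((K : ℝ) - j))) ^ 2 := by
          apply mul_le_mul_of_nonneg_left _ hC
          exact pow_le_pow_left₀ hp.le hgs.1 2
      _ = C / β' ^ 2 * (1 / ((K : ℝ) - j) ^ 2) := by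
          have hKj : (K : ℝ) - j ≠ 0 := by
            have : (j : ℝ) + 1 ≤ K := by exact_mod_cast hjK
            intro h; linarith
          field_simp
  have hC' : 0 ≤ C / β' ^ 2 := by positivity
  calc |∑ j ∈ Ico n K, (βE j (gsq j) - β₀seq j - β₂seq j * gsq j)|
        ≤ ∑ j ∈ Ico n K, |βE j (gsq j) - β₀seq j - β₂seq j * gsq j| := Finset.abs_sum_le_sum_abs _ _
    _ ≤ ∑ j ∈ Ico n K, C / β' ^ 2 * (1 / ((K : ℝ) - j) ^ 2) := Finset.sum_le_sum hterm
    _ = C / β' ^ 2 * ∑ i ∈ range (K - n), 1 / ((i : ℝ) + 1) ^ 2 := by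
          rw [← Finset.mul_sum, sum_Ico_reflect_sub (fun x => 1 / x ^ 2) hn]
    _ ≤ C / β' ^ 2 * 2 := mul_le_mul_of_nonneg_left (sum_range_one_div_sq_le_two (K - n)) hC'
    _ = 2 * C / β' ^ 2 := by ring

/-- Deviation of the inverse squared coupling from the one-loop line `y_n = 1/g² + |β₀|(K − n)` at step `n` of a run:
`|1/g_n² − y_n| ≤ D + (2B₂/|β′|)√(K − n) + 2C/β′²`, where `D` bounds the drift defect `|P(K) − P(n)|` of the window. -/
theorem abs_inv_gsq_sub_line_le {βE : ℕ → ℝ → ℝ} {gsq : ℕ → ℝ} {K : ℕ} {g β'' β' : ℝ}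
    (h362 : Recursion362 βE gsq K) (h371 : gsq K = g ^ 2) (h369 : AlongRun369 βE gsq β'' β' 0 K)
    (hβ' : β' < 0) (hg : 0 < g) (hpos : ∀ n, n ≤ K → 0 < gsq n)
    {β₀seq β₂seq : ℕ → ℝ} {C s₀ : ℝ} (h373 : TaylorSplit373 βE β₀seq β₂seq C s₀) (hgs₀ : g ^ 2 ≤ s₀)
    {B₂ : ℝ} (hB₂ : ∀ j, |β₂seq j| ≤ B₂) (β₀ : ℝ) {n : ℕ} (hn : n ≤ K) {D : ℝ}
    (hD : |(∑ j ∈ range K, β₀seq j - β₀ * K) - (∑ j ∈ range n, β₀seq j - β₀ * n)| ≤ D) :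
    |1 / gsq n - (1 / g ^ 2 + (-β₀) * ((K : ℝ) - n))| ≤
      D + 2 * B₂ / (-β') * Real.sqrt ((K : ℝ) - n) + 2 * C / β' ^ 2 := by
  have h1 := inv_gsq_eq_sub_tail h362 h371 hn
  rw [tail_split β₀seq β₂seq β₀ hn] at h1
  have h2 := abs_tail_twoLoop_le h362 h371 h369 hβ' hg hpos hB₂ hn
  have h3 := abs_tail_remainder_le h362 h371 h369 hβ' hg hpos h373 hgs₀ hn
  have heq : 1 / gsq n - (1 / g ^ 2 + (-β₀) * ((K : ℝ) - n)) =
      -(((∑ j ∈ range K, β₀seq j - β₀ * K) - (∑ j ∈ range n, β₀seq j - β₀ * n)) +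
        ∑ j ∈ Ico n K, β₂seq j * gsq j +
        ∑ j ∈ Ico n K, (βE j (gsq j) - β₀seq j - β₂seq j * gsq j)) := by
    rw [h1]
    ring
  rw [heq, abs_neg]
  calc _ ≤ |(∑ j ∈ range K, β₀seq j - β₀ * K) - (∑ j ∈ range n, β₀seq j - β₀ * n) +
          ∑ j ∈ Ico n K, β₂seq j * gsq j| + |∑ j ∈ Ico n K, (βE j (gsq j) - β₀seq j - β₂seq j * gsq j)| :=
        abs_add_le _ _
    _ ≤ |(∑ j ∈ range K, β₀seq j - β₀ * K) - (∑ j ∈ range n, β₀seq j - β₀ * n)| +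
          |∑ j ∈ Ico n K, β₂seq j * gsq j| + |∑ j ∈ Ico n K, (βE j (gsq j) - β₀seq j - β₂seq j * gsq j)| := by
        gcongr
        exact abs_add_le _ _
    _ ≤ D + 2 * B₂ / (-β') * Real.sqrt ((K : ℝ) - n) + 2 * C / β' ^ 2 := by
        gcongr

/-! ## §3 The core comparison and the assembly -/

/-- CORE COMPARISON along one run: the sum of the squared running couplings against the sum of the inverse one-loop
line, `|Σ_{j<K} g_j² − Σ_{j<K} 1/(1/g² + |β₀|(K − j))| ≤ 3·(D·g/(2√|β′|·|β₀|) + (2C/β′² + 2B₂/|β′|)/(|β′||β₀|))`,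
where `D ≥ 0` bounds every window drift defect `|P(K) − P(n)|`, `n ≤ K`.  The `D`-part carries the factor `g`. -/
theorem abs_sum_gsq_sub_sum_invLine_le {βE : ℕ → ℝ → ℝ} {gsq : ℕ → ℝ} {K : ℕ} {g β'' β' : ℝ}
    (h362 : Recursion362 βE gsq K) (h371 : gsq K = g ^ 2) (h369 : AlongRun369 βE gsq β'' β' 0 K)
    (hβ' : β' < 0) (hg : 0 < g) (hpos : ∀ n, n ≤ K → 0 < gsq n)
    {β₀seq β₂seq : ℕ → ℝ} {C s₀ : ℝ} (h373 : TaylorSplit373 βE β₀seq β₂seq C s₀) (hgs₀ : g ^ 2 ≤ s₀)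
    {B₂ : ℝ} (hB₂ : ∀ j, |β₂seq j| ≤ B₂) {β₀ : ℝ} (hβ₀ : β₀ < 0) {D : ℝ} (hD : 0 ≤ D)
    (hDall : ∀ n, n ≤ K →
      |(∑ j ∈ range K, β₀seq j - β₀ * K) - (∑ j ∈ range n, β₀seq j - β₀ * n)| ≤ D) :
    |∑ j ∈ range K, gsq j - ∑ j ∈ range K, 1 / (1 / g ^ 2 + (-β₀) * ((K : ℝ) - j))| ≤
      3 * (D * g / (2 * Real.sqrt (-β') * (-β₀)) + (2 * C / β' ^ 2 + 2 * B₂ / (-β')) / ((-β') * (-β₀))) := by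
  have hC := taylorConst_nonneg h373 hg hgs₀
  have hB₂0 : 0 ≤ B₂ := le_trans (abs_nonneg _) (hB₂ 0)
  have hb' : 0 < -β' := by linarith
  have hb₀ : 0 < -β₀ := by linarith
  have ha₁ : 0 ≤ 2 * C / β' ^ 2 := by positivity
  have ha₂ : 0 ≤ 2 * B₂ / (-β') := by positivity
  set coef := D * g / (2 * Real.sqrt (-β') * (-β₀)) + (2 * C / β' ^ 2 + 2 * B₂ / (-β')) / ((-β') * (-β₀))
    with hcoef
  have hterm : ∀ j ∈ range K, |gsq j - 1 / (1 / g ^ 2 + (-β₀) * ((K : ℝ) - j))| ≤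
      coef * (1 / (((K : ℝ) - j) * Real.sqrt ((K : ℝ) - j))) := by
    intro j hj
    have hjK := Finset.mem_range.mp hj
    have hm : (1 : ℝ) ≤ (K : ℝ) - j := by
      have : (j : ℝ) + 1 ≤ K := by exact_mod_cast hjK
      linarith
    have hx := lower_running h362 h371 h369 hjK.le
    have hdev := abs_inv_gsq_sub_line_le h362 h371 h369 hβ' hg hpos h373 hgs₀ hB₂ β₀ hjK.le (hDall j hjK.le)
    have h := abs_inv_sub_inv_le_of_line hm hg hb' hb₀ hx rfl hD ha₁ ha₂ hdev
    rwa [one_div_one_div] at h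
  calc |∑ j ∈ range K, gsq j - ∑ j ∈ range K, 1 / (1 / g ^ 2 + (-β₀) * ((K : ℝ) - j))|
        = |∑ j ∈ range K, (gsq j - 1 / (1 / g ^ 2 + (-β₀) * ((K : ℝ) - j)))| := by
          rw [Finset.sum_sub_distrib]
    _ ≤ ∑ j ∈ range K, |gsq j - 1 / (1 / g ^ 2 + (-β₀) * ((K : ℝ) - j))| := Finset.abs_sum_le_sum_abs _ _
    _ ≤ ∑ j ∈ range K, coef * (1 / (((K : ℝ) - j) * Real.sqrt ((K : ℝ) - j))) := Finset.sum_le_sum hterm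
    _ = coef * ∑ i ∈ range K, 1 / (((i : ℝ) + 1) * Real.sqrt ((i : ℝ) + 1)) := by
          rw [← Finset.mul_sum, sum_range_reflect_sub (fun x => 1 / (x * Real.sqrt x)) K]
    _ ≤ coef * 3 := mul_le_mul_of_nonneg_left (sum_inv_mul_sqrt_succ_le K) (by positivity)
    _ = 3 * coef := by ring

/-- From R2-F15 (iii) at `K = n + 1`: the two-loop coefficients are within `E` of `β₂` (hence bounded by `|β₂| + E`). -/
theorem abs_twoLoop_sub_le_of_iii {β₂seq : ℕ → ℝ} {β₂ E : ℝ}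
    (hE : ∀ K : ℕ, ∑ n ∈ range K, |β₂seq n - β₂| / ((K : ℝ) - n) ≤ E) (n : ℕ) : |β₂seq n - β₂| ≤ E := by
  have h := hE (n + 1)
  rw [Finset.sum_range_succ] at h
  have hlast : |β₂seq n - β₂| / (((n + 1 : ℕ) : ℝ) - n) = |β₂seq n - β₂| := by
    have : ((n + 1 : ℕ) : ℝ) - n = 1 := by push_cast; ring
    rw [this, div_one]
  have hrest : 0 ≤ ∑ x ∈ range n, |β₂seq x - β₂| / (((n + 1 : ℕ) : ℝ) - x) := by
    apply Finset.sum_nonneg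
    intro x hx
    have hx' := Finset.mem_range.mp hx
    have : (0 : ℝ) < ((n + 1 : ℕ) : ℝ) - x := by
      have : (x : ℝ) + 1 ≤ n := by exact_mod_cast hx'
      push_cast
      linarith
    positivity
  rw [hlast] at h
  linarith

/-- ASSEMBLY along one run (both directions use it): with `M_K = 1/g² − β₀K − (β₂/|β₀|)·log K` and the drift defect
`P(K) = Σ_{j<K} β_{j,0} − β₀K`,
`|1/g₀² − M_K + P(K)| ≤ 2C/β′² + E/|β′| + |β₂|·(3·coef(D) + 2g⁻²/β₀² + 1/|β₀|)`,
where `coef(D) = D·g/(2√|β′|·|β₀|) + (2C/β′² + 2(|β₂|+E)/|β′|)/(|β′||β₀|)` and `D` bounds the window defects. -/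
theorem run_assembly {βE : ℕ → ℝ → ℝ} {gsq : ℕ → ℝ} {K : ℕ} {g β'' β' : ℝ}
    (h362 : Recursion362 βE gsq K) (h371 : gsq K = g ^ 2) (h369 : AlongRun369 βE gsq β'' β' 0 K)
    (hβ' : β' < 0) (hg : 0 < g) (hpos : ∀ n, n ≤ K → 0 < gsq n)
    {β₀seq β₂seq : ℕ → ℝ} {C s₀ : ℝ} (h373 : TaylorSplit373 βE β₀seq β₂seq C s₀) (hgs₀ : g ^ 2 ≤ s₀)
    {β₀ β₂ E : ℝ} (hβ₀ : β₀ < 0) (hEall : ∀ n, |β₂seq n - β₂| ≤ E)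
    (hEK : ∑ n ∈ range K, |β₂seq n - β₂| / ((K : ℝ) - n) ≤ E) {D : ℝ} (hD : 0 ≤ D)
    (hDall : ∀ n, n ≤ K →
      |(∑ j ∈ range K, β₀seq j - β₀ * K) - (∑ j ∈ range n, β₀seq j - β₀ * n)| ≤ D) :
    |1 / gsq 0 - (1 / g ^ 2 - β₀ * K - β₂ / (-β₀) * Real.log K) + (∑ j ∈ range K, β₀seq j - β₀ * K)| ≤
      2 * C / β' ^ 2 + E / (-β') +
        |β₂| * (3 * (D * g / (2 * Real.sqrt (-β') * (-β₀)) +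
          (2 * C / β' ^ 2 + 2 * (|β₂| + E) / (-β')) / ((-β') * (-β₀))) +
          (2 * (1 / g ^ 2) / (-β₀) ^ 2 + 1 / (-β₀))) := by
  have hb' : 0 < -β' := by linarith
  have hb₀ : 0 < -β₀ := by linarith
  have hB₂ : ∀ j, |β₂seq j| ≤ |β₂| + E := fun j => by
    calc |β₂seq j| = |β₂ + (β₂seq j - β₂)| := by ring_nf
      _ ≤ |β₂| + |β₂seq j - β₂| := abs_add_le _ _
      _ ≤ |β₂| + E := by linarith [hEall j]
  -- the tail identity at n = 0
  have h1 := inv_gsq_eq_sub_tail h362 h371 (Nat.zero_le K)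
  rw [tail_split β₀seq β₂seq β₀ (Nat.zero_le K)] at h1
  simp only [Finset.range_zero, Finset.sum_empty, Nat.cast_zero, mul_zero, sub_zero, sub_self] at h1
  -- pieces
  have hR := abs_tail_remainder_le h362 h371 h369 hβ' hg hpos h373 hgs₀ (Nat.zero_le K)
  have hcore := abs_sum_gsq_sub_sum_invLine_le h362 h371 h369 hβ' hg hpos h373 hgs₀ hB₂ hβ₀ hD hDall
  have hlog := abs_sum_inv_affine_sub_log_le (c := 1 / g ^ 2) (b := -β₀) (by positivity) hb₀ K
  rw [← sum_range_reflect_sub (fun x => 1 / (1 / g ^ 2 + (-β₀) * x)) K] at hlog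
  -- the two-loop sum split: Σ β₂seq·gsq = Σ (β₂seq − β₂)·gsq + β₂ Σ gsq
  have hsplit : ∑ j ∈ Ico 0 K, β₂seq j * gsq j =
      ∑ j ∈ range K, (β₂seq j - β₂) * gsq j + β₂ * ∑ j ∈ range K, gsq j := by
    rw [Finset.range_eq_Ico, Finset.mul_sum, ← Finset.sum_add_distrib]
    exact Finset.sum_congr rfl fun j _ => by ring
  have hdev2 : |∑ j ∈ range K, (β₂seq j - β₂) * gsq j| ≤ E / (-β') := by
    have hterm : ∀ j ∈ range K, |(β₂seq j - β₂) * gsq j| ≤ 1 / (-β') * (|β₂seq j - β₂| / ((K : ℝ) - j)) := by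
      intro j hj
      have hjK := Finset.mem_range.mp hj
      have hgs := (gsq_le_of_run h362 h371 h369 hβ' hg hpos hjK).1
      have hp := hpos j hjK.le
      have hKj : 0 < (K : ℝ) - j := by
        have : (j : ℝ) + 1 ≤ K := by exact_mod_cast hjK
        linarith
      rw [abs_mul, abs_of_pos hp]
      calc |β₂seq j - β₂| * gsq j ≤ |β₂seq j - β₂| * (1 / ((-β') * ((K : ℝ) - j))) :=
            mul_le_mul_of_nonneg_left hgs (abs_nonneg _)
        _ = 1 / (-β') * (|β₂seq j - β₂| / ((K : ℝ) - j)) := by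
            field_simp
    calc |∑ j ∈ range K, (β₂seq j - β₂) * gsq j| ≤ ∑ j ∈ range K, |(β₂seq j - β₂) * gsq j| :=
          Finset.abs_sum_le_sum_abs _ _
      _ ≤ ∑ j ∈ range K, 1 / (-β') * (|β₂seq j - β₂| / ((K : ℝ) - j)) := Finset.sum_le_sum hterm
      _ = 1 / (-β') * ∑ j ∈ range K, |β₂seq j - β₂| / ((K : ℝ) - j) := by rw [Finset.mul_sum]
      _ ≤ 1 / (-β') * E := mul_le_mul_of_nonneg_left hEK (by positivity)
      _ = E / (-β') := by ring
  -- rewrite the target quantity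
  have heq : 1 / gsq 0 - (1 / g ^ 2 - β₀ * K - β₂ / (-β₀) * Real.log K) + (∑ j ∈ range K, β₀seq j - β₀ * K) =
      -(∑ j ∈ range K, (β₂seq j - β₂) * gsq j) -
        β₂ * (∑ j ∈ range K, gsq j - ∑ j ∈ range K, 1 / (1 / g ^ 2 + (-β₀) * ((K : ℝ) - j))) -
        β₂ * (∑ j ∈ range K, 1 / (1 / g ^ 2 + (-β₀) * ((K : ℝ) - j)) - 1 / (-β₀) * Real.log K) -
        ∑ j ∈ Ico 0 K, (βE j (gsq j) - β₀seq j - β₂seq j * gsq j) := by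
    rw [h1, hsplit]
    field_simp
    ring
  rw [heq]
  set a := ∑ j ∈ range K, (β₂seq j - β₂) * gsq j with ha
  set b := ∑ j ∈ range K, gsq j - ∑ j ∈ range K, 1 / (1 / g ^ 2 + (-β₀) * ((K : ℝ) - j)) with hb
  set c := ∑ j ∈ range K, 1 / (1 / g ^ 2 + (-β₀) * ((K : ℝ) - j)) - 1 / (-β₀) * Real.log K with hc
  set d := ∑ j ∈ Ico 0 K, (βE j (gsq j) - β₀seq j - β₂seq j * gsq j) with hd
  have htri : |-a - β₂ * b - β₂ * c - d| ≤ |a| + |β₂| * |b| + |β₂| * |c| + |d| := by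
    calc |-a - β₂ * b - β₂ * c - d| = |-(a + β₂ * b + β₂ * c + d)| := by ring_nf
      _ = |a + β₂ * b + β₂ * c + d| := abs_neg _
      _ ≤ |a + β₂ * b + β₂ * c| + |d| := abs_add_le _ _
      _ ≤ |a + β₂ * b| + |β₂ * c| + |d| := add_le_add (abs_add_le _ _) le_rfl
      _ ≤ |a| + |β₂ * b| + |β₂ * c| + |d| := add_le_add (add_le_add (abs_add_le _ _) le_rfl) le_rfl
      _ = |a| + |β₂| * |b| + |β₂| * |c| + |d| := by rw [abs_mul, abs_mul]
  have hβ₂abs := abs_nonneg β₂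
  calc |-a - β₂ * b - β₂ * c - d| ≤ |a| + |β₂| * |b| + |β₂| * |c| + |d| := htri
    _ ≤ E / (-β') + |β₂| * (3 * (D * g / (2 * Real.sqrt (-β') * (-β₀)) +
          (2 * C / β' ^ 2 + 2 * (|β₂| + E) / (-β')) / ((-β') * (-β₀)))) +
        |β₂| * (2 * (1 / g ^ 2) / (-β₀) ^ 2 + 1 / (-β₀)) + 2 * C / β' ^ 2 := by
        gcongr
    _ = _ := by ring

end

end Summit.QuantumFields.BalabanUV.Beta.EriceFlowEnclosureBareCouplingRun
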